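import Summits.QuantumFields.YangMills.Theorems.BalabanLadderUVSeamRecGaussianCalibrationCubes
import Summits.QuantumFields.YangMills.Theorems.BalabanLadderUVSeamRecGaussianCalibrationMoments
import HarnessLib

/-!
# Crux `UVSeamRec` (stmt-QuantumFields-20043), free-field calibration of (RM), file 3c: the SEPARATED-FAMILY OPERATOR BOUND for the
# response carriers of the lattice GFF of `ℤ⁴`

Helper file (`--supports stmt-QuantumFields-20043`) of the seam seat `ym-20043-seam-s2` (gen 3); one theorem, no definitions.

WHY.  The registered v5(α) stub `BirthV5A.stub_responseMomentsOdd6 : UV → (RM)` asks, for `2R+4`-separated families of cubes `Λ_i` of side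
`2R+3` centred at `x_i`, joint exponential moments of `(R⁴/C₁)|kerE_i − p_i|` with `kerE_i` the femto plane kernel of cube `i` (the conditional
expectation of the centre plaquette given the exterior).  Its documented (β-cl) architecture (p548409) needs (EM_lin): an extensive sub-Gaussian law
`exp(m Σ|tᵢ| + (v/2) Σ tᵢ²)` for the linear response carriers — an OPERATOR-NORM bound uniform in `R` and in the family (ceilings-p2 #54 §2:
Gershgorin/`ℓ¹` fails by `log` in `d = 4`).  FREE-FIELD TWIN (lattice GFF `ν` of `ℤ⁴`, covariance `latticeGreen/2`, tree `IsDiscreteGFF`): the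
response carrier of cube `i` is `L_i = R²·∇_{j_i} h_i(x_i)`, `h_i = φ − dirichletField Λ_i φ` the harmonic extension of the exterior field
(domain Markov property, tree `DiscreteGFFMarkov`/`DiscreteGFFDirichletField`), and `kerE_i − p_i = (L_i² − E L_i²)/R⁴`.  THIS FILE PROVES the
operator bound **`∫ (Σ_i t_i L_i)² dν ≤ v · Σ_i t_i²`** with an ABSOLUTE `v`, for every `R ≥ 1` and every family of centres pairwise `2R+4`-separated in
some coordinate (`exists_sq_integral_responseCarrier_le`).  Mechanism: (i) flux representation (file 1) `L_i = X_i − D_i`, `X_i = R²⟨avgKernel, ∇_{j}φ⟩`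
an INTERIOR linear statistic of cube `i`, `D_i` the same pairing of the Dirichlet part `dirichletField Λ_i φ`; (ii) `E[D_i L_{i'}] = 0` (the Dirichlet
part is orthogonal to every boundary statistic: `E[ψ^Λ_a φ_w] = G_Λ(a,w) = 0` off `Λ`), so `E(ΣtL)² ≤ E(ΣtX)²`; (iii) `E(ΣtX)² = ½ R⁴
greenEnergy(div M)` for the combined flux `M`, `≤ 4R⁴‖M‖²` (file 2), and `‖M‖² = Σ tᵢ²‖avgKernel‖² ≤ Σtᵢ²·K/r⁴` by DISJOINTNESS of the interior
fluxes of separated cubes (file 3b).  The (RM)/(EM_Q)-shaped calibration theorems follow in `…GaussianCalibrationLaw`.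

No sorry, standard axioms (one `maxHeartbeats 800000`: a single long bookkeeping proof).  HONEST FRAMING: a THEOREM about the massless lattice free
field — the Gaussian CONSISTENCY of the ℓ²-architecture of one OPEN binder of a CONDITIONAL chain; nothing of E0′ (interacting) is proved; not a gap, not Clay.
References: Friedli–Velenik 2017 Ch. 8 (GFF, Markov property); Lawler–Limic 2010 §6 (discrete potential theory).
-/

set_option autoImplicit false

noncomputable section

open MeasureTheory ProbabilityTheory Finset
open Literature.Probability.LatticeModels
open Literature.MathematicalPhysics.QuantumFieldTheory.LatticeForm (e)
open Summit.QuantumFields.YangMills.Theorems.WeakCouplingRates.HarmonicInterior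

namespace Summit.QuantumFields.YangMills.Cruxes.UVSeamRec.GaussianCalibration

/-! ## §4 The separated-family operator bound -/

section OperatorBound

variable {ν : Measure (Site 4 → ℝ)}

set_option maxHeartbeats 800000 in
/-- **Separated-family operator bound for the free-field response carriers.**  For the lattice GFF `ν` of `ℤ⁴` there is an ABSOLUTE `v > 0`
such that for every `R ≥ 1`, every finite family of cubes `Λ_i = x_i + sbox(R+1)` (side `2R+3`) whose centres are pairwise `2R+4`-separated in
some coordinate, every choice of directions `j_i`, and all reals `t_i`:
`∫ (Σ_i t_i · R²·∇_{j_i}(φ − ψ^{Λ_i})(x_i))² dν ≤ v · Σ_i t_i²`,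
where `φ − ψ^{Λ_i} = φ − dirichletField Λ_i φ` is the harmonic extension into `Λ_i` of the field outside (so `R²∇_{j_i}(φ − ψ^{Λ_i})(x_i)` is the
free-field response carrier of cube `i`).  This is (EM_lin) of the (β-cl) architecture with `m = 0` in the free field — the covariance operator of
the carriers of a separated family is bounded UNIFORMLY in `R` and the family. [cite: FriedliVelenik2017, Ch. 8 Thm. 8.21] -/
theorem exists_sq_integral_responseCarrier_le (hν : IsDiscreteGFF ν (coordProc 4)) :
    ∃ v : ℝ, 0 < v ∧ ∀ (R : ℕ), 1 ≤ R → ∀ (ι : Type) [Fintype ι] (j : ι → Fin 4) (x : ι → Site 4),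
      (∀ i i' : ι, i ≠ i' → ∃ k : Fin 4, 2 * (R : ℤ) + 4 ≤ |x i k - x i' k|) → ∀ t : ι → ℝ,
      ∫ φ, (∑ i, t i * ((R : ℝ) ^ 2 *
          ((φ (x i + e (j i)) - dirichletField ((sbox (R + 1)).image (fun z => x i + z)) φ (x i + e (j i))) -
           (φ (x i) - dirichletField ((sbox (R + 1)).image (fun z => x i + z)) φ (x i))))) ^ 2 ∂ν ≤
        v * ∑ i, (t i) ^ 2 := by
  classical
  obtain ⟨K, hK0, hK⟩ := exists_sum_avgKernel_sq_le
  refine ⟨1024 * K + 1, by positivity, fun R hR ι _ j x hsep t => ?_⟩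
  have hP := hν.1.isProbabilityMeasure
  -- radii
  set r : ℕ := (R + 3) / 4 with hr
  have hr1 : 1 ≤ r := by omega
  have hrR : 4 * r ≤ R + 3 := by omega
  have hRr : R ≤ 4 * r := by omega
  -- cubes and the common carrier
  set Λ : ι → Finset (Site 4) := fun i => (sbox (R + 1)).image (fun z => x i + z) with hΛ
  set S : Finset (Site 4) := Finset.univ.biUnion fun i => (sbox (R + 2)).image (fun z => x i + z) with hS
  have hΛS : ∀ i, (sbox (R + 2)).image (fun z => x i + z) ⊆ S := fun i =>
    Finset.subset_biUnion_of_mem (fun i => (sbox (R + 2)).image (fun z => x i + z)) (Finset.mem_univ i)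
  have hbdS : ∀ i, outerBoundary (zdGraph 4) (Λ i) ⊆ S := fun i =>
    (outerBoundary_image_sbox_subset (R + 1) (x i)).trans (hΛS i)
  have hxΛ : ∀ i, x i ∈ Λ i := fun i => by
    have h := add_mem_image_sbox (x i) (zero_mem_sbox (R + 1)); rwa [add_zero] at h
  have hxeΛ : ∀ i, x i + e (j i) ∈ Λ i := fun i => add_mem_image_sbox (x i) (e_mem_sbox (by omega) (j i))
  -- the statistics
  set L : ι → (Site 4 → ℝ) → ℝ := fun i φ => (R : ℝ) ^ 2 *
    ((φ (x i + e (j i)) - dirichletField (Λ i) φ (x i + e (j i))) - (φ (x i) - dirichletField (Λ i) φ (x i))) with hL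
  set Xs : ι → (Site 4 → ℝ) → ℝ := fun i φ => (R : ℝ) ^ 2 *
    ∑ z ∈ sbox (4 * r), avgKernel r z * (φ (x i + z + e (j i)) - φ (x i + z)) with hXs
  set D : ι → (Site 4 → ℝ) → ℝ := fun i φ => (R : ℝ) ^ 2 *
    ∑ z ∈ sbox (4 * r), avgKernel r z * (dirichletField (Λ i) φ (x i + z + e (j i)) - dirichletField (Λ i) φ (x i + z)) with hD
  -- (a) interior flux representation: L = Xs − D
  have hLXD : ∀ i φ, L i φ = Xs i φ - D i φ := by
    intro i φ
    have hharm : ∀ z : Site 4, (∀ k, |z k| ≤ 4 * (r : ℤ) - 2) →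
        latticeLaplacianZd (fun z => φ (x i + z) - dirichletField (Λ i) φ (x i + z)) z = 0 := by
      intro z hz
      set H : Site 4 → ℝ := fun w => φ w - dirichletField (Λ i) φ w with hH
      have e1 : (fun z => φ (x i + z) - dirichletField (Λ i) φ (x i + z)) = fun z => H (z + x i) := by
        funext w; simp only [hH, add_comm]
      rw [e1, latticeLaplacianZd_comp_add H (x i) z]
      refine latticeLaplacianZd_sub_dirichletField (by norm_num) (Λ i) φ ?_
      rw [add_comm]
      refine add_mem_image_sbox (x i) (mem_sbox.2 fun k => ?_)
      have := hz k; omega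
    have h := harmonic_sub_eq_sum_avgKernel (by omega) _ hharm (j i)
    simp only [add_zero] at h
    simp only [hL, hXs, hD, ← mul_sub, ← Finset.sum_sub_distrib]
    rw [h]
    congr 1
    refine Finset.sum_congr rfl fun z _ => ?_
    rw [add_assoc]
    ring
  -- (b) L as a boundary linear statistic, and orthogonality of the Dirichlet part
  have hLlin : ∀ i φ, L i φ = (R : ℝ) ^ 2 * ∑ w ∈ S,
      (Literature.Probability.LatticeModels.poissonKernel (Λ i) (x i + e (j i)) w -
        Literature.Probability.LatticeModels.poissonKernel (Λ i) (x i) w) * φ w := by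
    intro i φ
    simp only [hL]
    rw [sub_dirichletField_eq_sum (hbdS i) φ (hxeΛ i), sub_dirichletField_eq_sum (hbdS i) φ (hxΛ i),
      ← Finset.sum_sub_distrib]
    congr 1
    exact Finset.sum_congr rfl fun w _ => by ring
  have hint : ∀ i (a w : Site 4), Integrable (fun φ : Site 4 → ℝ => dirichletField (Λ i) φ a * φ w) ν := fun i a w =>
    ((hν.isGaussianProcess_dirichletField (Λ i)).hasGaussianLaw_eval a).memLp_two.integrable_mul (hν.memLp_coord w)
  have horth : ∀ i i', ∫ φ, D i φ * L i' φ ∂ν = 0 := by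
    intro i i'
    set c : Site 4 → ℝ := fun w => Literature.Probability.LatticeModels.poissonKernel (Λ i') (x i' + e (j i')) w -
      Literature.Probability.LatticeModels.poissonKernel (Λ i') (x i') w with hc
    have hzero : ∀ a w : Site 4, c w * ∫ φ, dirichletField (Λ i) φ a * φ w ∂ν = 0 := by
      intro a w
      by_cases hw : w ∈ outerBoundary (zdGraph 4) (Λ i')
      · rw [hν.integral_dirichletField_mul_coord (by norm_num) (Λ i) a w,
          dirichletGreen_of_not_mem_right (Λ i) a (not_mem_of_mem_outerBoundary hsep i i' hw), mul_zero]
      · simp only [hc]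
        rw [poissonKernel_eq_zero_of_not_mem_outerBoundary _ _ hw, poissonKernel_eq_zero_of_not_mem_outerBoundary _ _ hw,
          sub_self, zero_mul]
    have hexp : ∀ φ : Site 4 → ℝ, D i φ * L i' φ = ∑ z ∈ sbox (4 * r), ∑ w ∈ S, (R : ℝ) ^ 4 * avgKernel r z *
        (c w * (dirichletField (Λ i) φ (x i + z + e (j i)) * φ w) - c w * (dirichletField (Λ i) φ (x i + z) * φ w)) := by
      intro φ
      rw [hLlin i' φ]
      simp only [hD]
      rw [show ∀ A B : ℝ, (R : ℝ) ^ 2 * A * ((R : ℝ) ^ 2 * B) = (R : ℝ) ^ 4 * (A * B) from fun A B => by ring,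
        Finset.sum_mul_sum, Finset.mul_sum]
      refine Finset.sum_congr rfl fun z _ => ?_
      rw [Finset.mul_sum]
      exact Finset.sum_congr rfl fun w _ => by simp only [hc]; ring
    have hI : ∀ z w, Integrable (fun φ : Site 4 → ℝ => (R : ℝ) ^ 4 * avgKernel r z *
        (c w * (dirichletField (Λ i) φ (x i + z + e (j i)) * φ w) - c w * (dirichletField (Λ i) φ (x i + z) * φ w))) ν :=
      fun z w => (((hint i _ w).const_mul (c w)).sub ((hint i _ w).const_mul (c w))).const_mul _
    simp_rw [hexp]
    rw [integral_finsetSum _ fun z _ => integrable_finsetSum _ fun w _ => hI z w]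
    refine Finset.sum_eq_zero fun z _ => ?_
    rw [integral_finsetSum _ fun w _ => hI z w]
    refine Finset.sum_eq_zero fun w _ => ?_
    rw [integral_const_mul, integral_sub ((hint i _ w).const_mul (c w)) ((hint i _ w).const_mul (c w)),
      integral_const_mul, integral_const_mul, hzero, hzero, sub_self, mul_zero]
  -- (c) square integrability and the comparison E(ΣtL)² ≤ E(ΣtX)²
  have hL2 : ∀ i, MemLp (L i) 2 ν := by
    intro i
    simp only [hL]
    exact (((hν.memLp_coord _).sub (((hν.isGaussianProcess_dirichletField (Λ i)).hasGaussianLaw_eval _).memLp_two)).sub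
      ((hν.memLp_coord _).sub (((hν.isGaussianProcess_dirichletField (Λ i)).hasGaussianLaw_eval _).memLp_two))).const_mul _
  have hD2 : ∀ i, MemLp (D i) 2 ν := by
    intro i
    simp only [hD]
    refine (memLp_finsetSum (sbox (4 * r))
      (f := fun z φ => avgKernel r z * (dirichletField (Λ i) φ (x i + z + e (j i)) - dirichletField (Λ i) φ (x i + z)))
      fun z _ => ?_).const_mul _
    exact ((((hν.isGaussianProcess_dirichletField (Λ i)).hasGaussianLaw_eval _).memLp_two).sub
      (((hν.isGaussianProcess_dirichletField (Λ i)).hasGaussianLaw_eval _).memLp_two)).const_mul _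
  set YL : (Site 4 → ℝ) → ℝ := fun φ => ∑ i, t i * L i φ with hYL
  set YX : (Site 4 → ℝ) → ℝ := fun φ => ∑ i, t i * Xs i φ with hYX
  set YD : (Site 4 → ℝ) → ℝ := fun φ => ∑ i, t i * D i φ with hYD
  have hYL2 : MemLp YL 2 ν := memLp_finsetSum Finset.univ (f := fun i φ => t i * L i φ) fun i _ => (hL2 i).const_mul _
  have hYD2 : MemLp YD 2 ν := memLp_finsetSum Finset.univ (f := fun i φ => t i * D i φ) fun i _ => (hD2 i).const_mul _
  have hYXeq : ∀ φ, YX φ = YL φ + YD φ := by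
    intro φ
    simp only [hYL, hYD, hYX, ← Finset.sum_add_distrib, hLXD]
    exact Finset.sum_congr rfl fun i _ => by ring
  have hcross : ∫ φ, YD φ * YL φ ∂ν = 0 := by
    have hexp : ∀ φ, YD φ * YL φ = ∑ i, ∑ i', t i * t i' * (D i φ * L i' φ) := by
      intro φ
      simp only [hYD, hYL]
      rw [Finset.sum_mul_sum]
      exact Finset.sum_congr rfl fun i _ => Finset.sum_congr rfl fun i' _ => by ring
    have hI : ∀ i i', Integrable (fun φ => t i * t i' * (D i φ * L i' φ)) ν :=
      fun i i' => ((hD2 i).integrable_mul (hL2 i')).const_mul _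
    simp_rw [hexp]
    rw [integral_finsetSum _ fun i _ => integrable_finsetSum _ fun i' _ => hI i i']
    refine Finset.sum_eq_zero fun i _ => ?_
    rw [integral_finsetSum _ fun i' _ => hI i i']
    refine Finset.sum_eq_zero fun i' _ => ?_
    rw [integral_const_mul]
    have := horth i i'
    simp only [mul_eq_zero]
    exact Or.inr this
  have hcomp : ∫ φ, (YL φ) ^ 2 ∂ν ≤ ∫ φ, (YX φ) ^ 2 ∂ν := by
    have e1 : ∀ φ, (YX φ) ^ 2 = (YL φ) ^ 2 + 2 * (YD φ * YL φ) + (YD φ) ^ 2 := by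
      intro φ; rw [hYXeq φ]; ring
    simp_rw [e1]
    have i1 : Integrable (fun φ => (YL φ) ^ 2) ν := hYL2.integrable_sq
    have i2 : Integrable (fun φ => 2 * (YD φ * YL φ)) ν := by
      have h := (hYD2.integrable_mul hYL2).const_mul 2
      simpa only [Pi.mul_apply] using h
    have i3 : Integrable (fun φ => (YD φ) ^ 2) ν := hYD2.integrable_sq
    have i12 : Integrable (fun φ => (YL φ) ^ 2 + 2 * (YD φ * YL φ)) ν := i1.add i2
    rw [integral_add i12 i3, integral_add i1 i2, integral_const_mul, hcross, mul_zero, add_zero]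
    have : 0 ≤ ∫ φ, (YD φ) ^ 2 ∂ν := integral_nonneg fun φ => sq_nonneg _
    linarith
  -- (d) ΣtX as ONE linear statistic: the combined flux M and its divergence
  set M : Fin 4 → Site 4 → ℝ := fun j' w => ∑ i ∈ Finset.univ.filter (fun i => j i = j'), t i * avgKernel r (w - x i)
    with hM
  have hMsupp : ∀ j' w, M j' w ≠ 0 → w ∈ S ∧ w + Pi.single j' 1 ∈ S := by
    intro j' w hw
    obtain ⟨i, -, hne⟩ := Finset.exists_ne_zero_of_sum_ne_zero hw
    have hne' : avgKernel r (w - x i) ≠ 0 := fun h => hne (by rw [h, mul_zero])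
    obtain ⟨h1, h2⟩ := mem_of_avgKernel_ne_zero hrR (x i) hne' j'
    exact ⟨hΛS i h1, hΛS i h2⟩
  have hYXlin : ∀ φ, YX φ = ∑ w ∈ S, ((R : ℝ) ^ 2 * ∑ j', (M j' (w - Pi.single j' 1) - M j' w)) * φ w := by
    intro φ
    have h1 : ∀ i, Xs i φ = (R : ℝ) ^ 2 * ∑ w ∈ S, avgKernel r (w - x i) * (φ (w + e (j i)) - φ w) := by
      intro i
      simp only [hXs]
      congr 1
      have := sum_sbox_avgKernel_eq_sum hrR (x i) (hΛS i) (fun w => φ (w + e (j i)) - φ w)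
      simpa only [add_assoc] using this
    have h2 : ∑ i, t i * Xs i φ = (R : ℝ) ^ 2 * ∑ j', ∑ w ∈ S, M j' w * (φ (w + Pi.single j' 1) - φ w) := by
      rw [← Finset.sum_fiberwise_of_maps_to (s := Finset.univ) (t := Finset.univ) (g := j) fun i _ => Finset.mem_univ _]
      rw [Finset.mul_sum]
      refine Finset.sum_congr rfl fun j' _ => ?_
      have h3 : ∀ i ∈ Finset.univ.filter (fun i => j i = j'),
          t i * Xs i φ = ∑ w ∈ S, (R : ℝ) ^ 2 * ((t i * avgKernel r (w - x i)) * (φ (w + Pi.single j' 1) - φ w)) := by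
        intro i hi
        have hji : j i = j' := (Finset.mem_filter.1 hi).2
        rw [h1 i, Finset.mul_sum, Finset.mul_sum]
        refine Finset.sum_congr rfl fun w _ => ?_
        rw [← hji, ← e_def]
        ring
      rw [Finset.sum_congr rfl h3, Finset.sum_comm, Finset.mul_sum]
      refine Finset.sum_congr rfl fun w _ => ?_
      simp only [hM]
      rw [Finset.sum_mul, Finset.mul_sum]
    simp only [hYX]
    rw [h2, sum_flux_eq_linStat S M hMsupp φ, Finset.mul_sum]
    exact Finset.sum_congr rfl fun w _ => by ring
  -- (e) its second moment is `½ R⁴ · greenEnergy(div M) ≤ 4 R⁴ ‖M‖²`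
  have hYXsq : ∫ φ, (YX φ) ^ 2 ∂ν =
      (R : ℝ) ^ 4 * (greenEnergy S (fun w => ∑ j', (M j' (w - Pi.single j' 1) - M j' w)) / 2) := by
    have e1 : ∀ φ, (YX φ) ^ 2 =
        (R : ℝ) ^ 4 * (∑ w ∈ S, (∑ j', (M j' (w - Pi.single j' 1) - M j' w)) * φ w) ^ 2 := by
      intro φ
      rw [hYXlin φ]
      have : ∑ w ∈ S, ((R : ℝ) ^ 2 * ∑ j', (M j' (w - Pi.single j' 1) - M j' w)) * φ w =
          (R : ℝ) ^ 2 * ∑ w ∈ S, (∑ j', (M j' (w - Pi.single j' 1) - M j' w)) * φ w := by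
        rw [Finset.mul_sum]; exact Finset.sum_congr rfl fun w _ => by ring
      rw [this]; ring
    simp_rw [e1]
    rw [integral_const_mul, integral_linStat_sq hν S]
  have hgE : greenEnergy S (fun w => ∑ j', (M j' (w - Pi.single j' 1) - M j' w)) ≤
      2 * ((4 : ℕ) : ℝ) * ∑ j', ∑ w ∈ S, (M j' w) ^ 2 :=
    greenEnergy_div_le (by norm_num) S M hMsupp
  -- (f) disjoint supports: ‖M‖² = Σ tᵢ² ‖avgKernel‖²
  have hMsq : ∀ j' w, (M j' w) ^ 2 = ∑ i ∈ Finset.univ.filter (fun i => j i = j'), (t i) ^ 2 * (avgKernel r (w - x i)) ^ 2 := by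
    intro j' w
    simp only [hM]
    rw [sq, Finset.sum_mul_sum]
    refine Finset.sum_congr rfl fun i hi => ?_
    rw [Finset.sum_eq_single i (fun i' _ hne => ?_) (fun h => absurd hi h)]
    · ring
    · by_cases h1 : avgKernel r (w - x i) = 0
      · rw [h1]; ring
      · by_cases h2 : avgKernel r (w - x i') = 0
        · rw [h2]; ring
        · exact absurd (eq_of_avgKernel_ne_zero hrR hsep h1 h2) (Ne.symm hne)
  have hsumsq : ∑ j', ∑ w ∈ S, (M j' w) ^ 2 = ∑ i, (t i) ^ 2 * ∑ w ∈ S, (avgKernel r (w - x i)) ^ 2 := by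
    simp_rw [hMsq]
    rw [Finset.sum_comm]
    simp_rw [Finset.mul_sum]
    rw [Finset.sum_comm (s := Finset.univ) (t := S)]
    refine Finset.sum_congr rfl fun w _ => ?_
    exact Finset.sum_fiberwise_of_maps_to (s := Finset.univ) (t := Finset.univ) (g := j) (fun i _ => Finset.mem_univ _) _
  have ha2 : ∀ i, ∑ w ∈ S, (avgKernel r (w - x i)) ^ 2 ≤ K / (r : ℝ) ^ 4 := by
    intro i
    have h := hK r hr1 (S.image (fun w => w - x i))
    rwa [Finset.sum_image fun a _ b _ h => sub_left_injective h] at h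
  -- (g) assemble
  have hrpos : (0 : ℝ) < r := by exact_mod_cast hr1
  have hRr' : (R : ℝ) ^ 4 ≤ 256 * (r : ℝ) ^ 4 := by
    have : (R : ℝ) ≤ 4 * r := by exact_mod_cast hRr
    have h4 : (R : ℝ) ^ 4 ≤ (4 * (r : ℝ)) ^ 4 := pow_le_pow_left₀ (by positivity) this 4
    nlinarith
  have ht0 : 0 ≤ ∑ i, (t i) ^ 2 := Finset.sum_nonneg fun i _ => sq_nonneg _
  have key : ∫ φ, (YL φ) ^ 2 ∂ν ≤ (1024 * K + 1) * ∑ i, (t i) ^ 2 :=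
  calc ∫ φ, (YL φ) ^ 2 ∂ν ≤ ∫ φ, (YX φ) ^ 2 ∂ν := hcomp
    _ = (R : ℝ) ^ 4 * (greenEnergy S (fun w => ∑ j', (M j' (w - Pi.single j' 1) - M j' w)) / 2) := hYXsq
    _ ≤ (R : ℝ) ^ 4 * ((2 * ((4 : ℕ) : ℝ) * ∑ j', ∑ w ∈ S, (M j' w) ^ 2) / 2) := by gcongr
    _ = 4 * (R : ℝ) ^ 4 * ∑ i, (t i) ^ 2 * ∑ w ∈ S, (avgKernel r (w - x i)) ^ 2 := by rw [hsumsq]; push_cast; ring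
    _ ≤ 4 * (R : ℝ) ^ 4 * ∑ i, (t i) ^ 2 * (K / (r : ℝ) ^ 4) := by
        gcongr with i _
        exact ha2 i
    _ = 4 * K * ((R : ℝ) ^ 4 / (r : ℝ) ^ 4) * ∑ i, (t i) ^ 2 := by rw [← Finset.sum_mul]; field_simp
    _ ≤ 4 * K * 256 * ∑ i, (t i) ^ 2 := by
        gcongr
        rw [div_le_iff₀ (by positivity)]
        exact hRr'
    _ ≤ (1024 * K + 1) * ∑ i, (t i) ^ 2 := by nlinarith
  exact key

end OperatorBound

end Summit.QuantumFields.YangMills.Cruxes.UVSeamRec.GaussianCalibration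

end
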